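import Summits.CriticalPhenomena.PercolationContinuityZ3.Theorems.PercNearOneGluingNoHeavyQuantFarGate3LawK
import Summits.CriticalPhenomena.PercolationContinuityZ3.Theorems.PercNearOneGluingNoHeavyQuantFarGate3HarrisK
import Summits.CriticalPhenomena.PercolationContinuityZ3.Theorems.PercNearOneGluingNoHeavyQuantFarGate3Outside
import Summits.CriticalPhenomena.PercolationContinuityZ3.Theorems.PercNearOneGluingNoHeavyQuantFarGate3Cells
import Summits.CriticalPhenomena.PercolationContinuityZ3.Theorems.PercNearOneGluingNoHeavyQuantFarGate3Law
import HarnessLib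

/-!
# QUANT lane R8, front "FAR beyond trees", layer one — THE DEGREE-THREE GATE AT THE OBSERVER, XX: assembly modulo the SIX-ROW cover lemma

builds on p205010 (kernel theorem, internal audit signed; external expert review pending)

Support file (`--supports stmt-CriticalPhenomena-4575`), seat `prim-quant-p1` (gen 28); memo
`run/shared/lean/prim/quant/prim-quant-p1-g28/FOR-LEAD-GATE3.md` §5.  Standard axioms; no sorries; no definitions.

**`Quant.farLayerOne_of_gate3_of_cover₆`.**  File XIII with the THREE K-ROWS of file XIX added to the hypothesis `hcover`
(`P(X)·P(K≥1) ≤ P(X ∧ K≥1)` for `X ∈ {G₁,G₂,H}`, in cells: `(b₁+d)(1 − Σ_{k=0} x) ≤ b₁₁+b₁₂+d₁+d₂` etc.).  The global LP scan (kit j207484,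
memo §1) shows the three union rows alone do NOT imply the cover at tiny `p`, `8 ≤ n ≲ 20` (exact value `+3.8e-4`), while union + K rows do
(0 exact positives on 12 740 cells): so THIS is the assembly through which the general gate must go; every regime proved from the weaker
`hcover` of XIII (files XIV–XVIII) is a fortiori a regime of this one.
[cite: KozmaNitzan2024, Conjecture 3 (p. 15)]; [cite: Grimmett1999, §1.3 p. 10, §2.2, Thm. (2.4) p. 34]; [this work].
-/

noncomputable section

namespace Summit.CriticalPhenomena.PercolationContinuityZ3.Theorems

namespace Quant

open Finset MeasureTheory Set
open Literature.Probability.LatticeModels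
open Literature.Probability.Percolation
open Bundle (offZ)
open scoped Classical

variable {n : ℕ}

/-- **FAR(1) for the degree-three gate at the observer, modulo the SIX-ROW cover lemma `hcover`** (three union rows + three K-rows; memo §1, §5). [this work] -/
theorem farLayerOne_of_gate3_of_cover₆ (w : Sym2 (Fin n) → unitInterval) (A : Finset (Fin n)) {o v u₁ u₂ : Fin n}
    (hov : o ≠ v) (h1v : u₁ ≠ v) (h2v : u₂ ≠ v) (ho1 : o ≠ u₁) (ho2 : o ≠ u₂) (h12 : u₁ ≠ u₂)
    (hvA : v ∈ A) (h1A : u₁ ∈ A) (h2A : u₂ ∈ A)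
    (hw : ∀ z : Fin n, z ≠ o → z ≠ u₁ → z ≠ u₂ → z ≠ v → (w s(v, z) : ℝ) = 0)
    (hcover : ∀ (t S a0 a1 a2 b10 b11 b12 b20 b21 b22 c0 c1 c2 d0 d1 d2 : ℝ), 0 ≤ a0 → 0 ≤ a1 → 0 ≤ a2 → 0 ≤ b10 → 0 ≤ b11 → 0 ≤ b12 → 0 ≤ b20 → 0 ≤ b21 → 0 ≤ b22 → 0 ≤ c0 → 0 ≤ c1 → 0 ≤ c2 → 0 ≤ d0 → 0 ≤ d1 → 0 ≤ d2 →
        a0 + a1 + a2 + b10 + b11 + b12 + b20 + b21 + b22 + c0 + c1 + c2 + d0 + d1 + d2 = 1 →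
        ((a0 + a1 + a2) + (c0 + c1 + c2) + (b20 + b21 + b22)) * ((a0 + a1 + a2) + (b10 + b11 + b12)) ≤ (a0 + a1 + a2) →
        ((a0 + a1 + a2) + (c0 + c1 + c2) + (b10 + b11 + b12)) * ((a0 + a1 + a2) + (b20 + b21 + b22)) ≤ (a0 + a1 + a2) →
        ((a0 + a1 + a2) + (b10 + b11 + b12) + (b20 + b21 + b22)) * ((a0 + a1 + a2) + (c0 + c1 + c2)) ≤ (a0 + a1 + a2) →
        ((b10 + b11 + b12) + (d0 + d1 + d2)) * (1 - (a0 + b10 + b20 + c0 + d0)) ≤ (b11 + b12) + (d1 + d2) →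
        ((b20 + b21 + b22) + (d0 + d1 + d2)) * (1 - (a0 + b10 + b20 + c0 + d0)) ≤ (b21 + b22) + (d1 + d2) →
        ((c0 + c1 + c2) + (d0 + d1 + d2)) * (1 - (a0 + b10 + b20 + c0 + d0)) ≤ (c1 + c2) + (d1 + d2) →
        (1 - (w s(o, v) : ℝ)) * ((w s(v, u₁) : ℝ) * (w s(v, u₂) : ℝ)) * ((a0 + a1 + a2) + (c0 + c1 + c2)) + (1 - (w s(o, v) : ℝ)) * ((w s(v, u₁) : ℝ) * (1 - (w s(v, u₂) : ℝ))) * ((a0 + a1 + a2) + (c0 + c1 + c2) + (b20 + b21 + b22)) + (1 - (w s(o, v) : ℝ)) * ((1 - (w s(v, u₁) : ℝ)) * (w s(v, u₂) : ℝ)) * ((a0 + a1 + a2) + (c0 + c1 + c2) + (b10 + b11 + b12)) + (1 - (w s(o, v) : ℝ)) * ((1 - (w s(v, u₁) : ℝ)) * (1 - (w s(v, u₂) : ℝ))) ≤ t →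
        (w s(o, v) : ℝ) * ((1 - (w s(v, u₁) : ℝ)) * (w s(v, u₂) : ℝ)) * ((a0 + a1 + a2) + (b20 + b21 + b22)) + (1 - (w s(o, v) : ℝ)) * ((w s(v, u₁) : ℝ) * (w s(v, u₂) : ℝ)) * ((a0 + a1 + a2) + (c0 + c1 + c2)) + ((w s(o, v) : ℝ) * ((1 - (w s(v, u₁) : ℝ)) * (1 - (w s(v, u₂) : ℝ))) + (1 - (w s(o, v) : ℝ)) * ((w s(v, u₁) : ℝ) * (1 - (w s(v, u₂) : ℝ))) + (1 - (w s(o, v) : ℝ)) * ((1 - (w s(v, u₁) : ℝ)) * (w s(v, u₂) : ℝ)) + (1 - (w s(o, v) : ℝ)) * ((1 - (w s(v, u₁) : ℝ)) * (1 - (w s(v, u₂) : ℝ)))) * ((a0 + a1 + a2) + (c0 + c1 + c2) + (b20 + b21 + b22)) ≤ t →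
        (w s(o, v) : ℝ) * ((1 - (w s(v, u₂) : ℝ)) * (w s(v, u₁) : ℝ)) * ((a0 + a1 + a2) + (b10 + b11 + b12)) + (1 - (w s(o, v) : ℝ)) * ((w s(v, u₂) : ℝ) * (w s(v, u₁) : ℝ)) * ((a0 + a1 + a2) + (c0 + c1 + c2)) + ((w s(o, v) : ℝ) * ((1 - (w s(v, u₂) : ℝ)) * (1 - (w s(v, u₁) : ℝ))) + (1 - (w s(o, v) : ℝ)) * ((w s(v, u₂) : ℝ) * (1 - (w s(v, u₁) : ℝ))) + (1 - (w s(o, v) : ℝ)) * ((1 - (w s(v, u₂) : ℝ)) * (w s(v, u₁) : ℝ)) + (1 - (w s(o, v) : ℝ)) * ((1 - (w s(v, u₂) : ℝ)) * (1 - (w s(v, u₁) : ℝ)))) * ((a0 + a1 + a2) + (c0 + c1 + c2) + (b10 + b11 + b12)) ≤ t →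
        ((((A.erase v).erase u₁).erase u₂).card : ℝ) - S ≤ ((((A.erase v).erase u₁).erase u₂).card : ℝ) * t →
        S ≤ ((w s(o, v) : ℝ) * max (w s(v, u₁) : ℝ) (w s(v, u₂) : ℝ) * ((((A.erase v).erase u₁).erase u₂).card : ℝ) * a0 + (1 + (w s(o, v) : ℝ) * max (w s(v, u₁) : ℝ) (w s(v, u₂) : ℝ) * (((((A.erase v).erase u₁).erase u₂).card : ℝ) - 1)) * a1 + ((((A.erase v).erase u₁).erase u₂).card : ℝ) * a2) + ((1 - (1 - (w s(o, v) : ℝ)) * (1 - (w s(v, u₁) : ℝ))) * (w s(v, u₂) : ℝ) * ((((A.erase v).erase u₁).erase u₂).card : ℝ) * b10 + (1 + (1 - (1 - (w s(o, v) : ℝ)) * (1 - (w s(v, u₁) : ℝ))) * (w s(v, u₂) : ℝ) * (((((A.erase v).erase u₁).erase u₂).card : ℝ) - 1)) * b11 + ((((A.erase v).erase u₁).erase u₂).card : ℝ) * b12) + ((1 - (1 - (w s(o, v) : ℝ)) * (1 - (w s(v, u₂) : ℝ))) * (w s(v, u₁) : ℝ) * ((((A.erase v).erase u₁).erase u₂).card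 : ℝ) * b20 + (1 + (1 - (1 - (w s(o, v) : ℝ)) * (1 - (w s(v, u₂) : ℝ))) * (w s(v, u₁) : ℝ) * (((((A.erase v).erase u₁).erase u₂).card : ℝ) - 1)) * b21 + ((((A.erase v).erase u₁).erase u₂).card : ℝ) * b22) + ((w s(o, v) : ℝ) * (1 - (1 - (w s(v, u₁) : ℝ)) * (1 - (w s(v, u₂) : ℝ))) * ((((A.erase v).erase u₁).erase u₂).card : ℝ) * c0 + (1 + (w s(o, v) : ℝ) * (1 - (1 - (w s(v, u₁) : ℝ)) * (1 - (w s(v, u₂) : ℝ))) * (((((A.erase v).erase u₁).erase u₂).card : ℝ) - 1)) * c1 + ((((A.erase v).erase u₁).erase u₂).card : ℝ) * c2) + ((1 : ℝ) * d1 + ((((A.erase v).erase u₁).erase u₂).card : ℝ) * d2) →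
        2 < (1 - ((1 - (w s(o, v) : ℝ)) * ((w s(v, u₁) : ℝ) * (w s(v, u₂) : ℝ)) * ((a0 + a1 + a2) + (c0 + c1 + c2)) + (1 - (w s(o, v) : ℝ)) * ((w s(v, u₁) : ℝ) * (1 - (w s(v, u₂) : ℝ))) * ((a0 + a1 + a2) + (c0 + c1 + c2) + (b20 + b21 + b22)) + (1 - (w s(o, v) : ℝ)) * ((1 - (w s(v, u₁) : ℝ)) * (w s(v, u₂) : ℝ)) * ((a0 + a1 + a2) + (c0 + c1 + c2) + (b10 + b11 + b12)) + (1 - (w s(o, v) : ℝ)) * ((1 - (w s(v, u₁) : ℝ)) * (1 - (w s(v, u₂) : ℝ))))) + (1 - ((w s(o, v) : ℝ) * ((1 - (w s(v, u₁) : ℝ)) * (w s(v, u₂) : ℝ)) * ((a0 + a1 + a2) + (b20 + b21 + b22)) + (1 - (w s(o, v) : ℝ)) * ((w s(v, u₁) : ℝ) * (w s(v, u₂) : ℝ)) * ((a0 + a1 + a2) + (c0 + c1 + c2)) + ((w s(o, v) : ℝ) * ((1 - (w s(v, u₁) : ℝ)) * (1 - (w s(v, u₂) : ℝ))) + (1 -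 (w s(o, v) : ℝ)) * ((w s(v, u₁) : ℝ) * (1 - (w s(v, u₂) : ℝ))) + (1 - (w s(o, v) : ℝ)) * ((1 - (w s(v, u₁) : ℝ)) * (w s(v, u₂) : ℝ)) + (1 - (w s(o, v) : ℝ)) * ((1 - (w s(v, u₁) : ℝ)) * (1 - (w s(v, u₂) : ℝ)))) * ((a0 + a1 + a2) + (c0 + c1 + c2) + (b20 + b21 + b22)))) + (1 - ((w s(o, v) : ℝ) * ((1 - (w s(v, u₂) : ℝ)) * (w s(v, u₁) : ℝ)) * ((a0 + a1 + a2) + (b10 + b11 + b12)) + (1 - (w s(o, v) : ℝ)) * ((w s(v, u₂) : ℝ) * (w s(v, u₁) : ℝ)) * ((a0 + a1 + a2) + (c0 + c1 + c2)) + ((w s(o, v) : ℝ) * ((1 - (w s(v, u₂) : ℝ)) * (1 - (w s(v, u₁) : ℝ))) + (1 - (w s(o, v) : ℝ)) * ((w s(v, u₂) : ℝ) * (1 - (w s(v, u₁) : ℝ))) + (1 - (w s(o, v) : ℝ)) * ((1 - (w s(v, u₂) : ℝ)) * (w s(v, u₁) : ℝ)) + (1 - (w s(o, v) : ℝ)) *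 ((1 - (w s(v, u₂) : ℝ)) * (1 - (w s(v, u₁) : ℝ)))) * ((a0 + a1 + a2) + (c0 + c1 + c2) + (b10 + b11 + b12)))) + S →
        (w s(o, v) : ℝ) * ((1 - (w s(v, u₁) : ℝ)) * (1 - (w s(v, u₂) : ℝ))) * (a0 + c0) + (1 - (w s(o, v) : ℝ)) * ((w s(v, u₁) : ℝ) * (w s(v, u₂) : ℝ)) * (a0 + a1 + c0 + c1) + (1 - (w s(o, v) : ℝ)) * ((w s(v, u₁) : ℝ) * (1 - (w s(v, u₂) : ℝ))) * (a0 + a1 + c0 + c1 + b20) + (1 - (w s(o, v) : ℝ)) * ((1 - (w s(v, u₁) : ℝ)) * (w s(v, u₂) : ℝ)) * (a0 + a1 + c0 + c1 + b10) + (1 - (w s(o, v) : ℝ)) * ((1 - (w s(v, u₁) : ℝ)) * (1 - (w s(v, u₂) : ℝ))) * (a0 + a1 + c0 + c1 + b10 + b20) ≤ t)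
    (t : ℝ) (hEN : 2 < ∑ a ∈ A, (prodBernoulli w).real (openConn o a))
    (hcut : ∀ a ∈ A, (prodBernoulli w).real (openConn o a : Set (BondConfig (Fin n)))ᶜ ≤ t) :
    (prodBernoulli w).real {ω : BondConfig (Fin n) | (A.filter fun a => ω ∈ openConn o a).card ≤ 1} ≤ t := by
  set μ := prodBernoulli w with hμ
  have hmeas : ∀ U : Set (BondConfig (Fin n)), MeasurableSet U := fun U => (Set.toFinite U).measurableSet
  have hcomp : ∀ a : Fin n, μ.real (openConn o a : Set (BondConfig (Fin n)))ᶜ = 1 - μ.real (openConn o a) :=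
    fun a => probReal_compl_eq_one_sub (hmeas _)
  -- the outside relays `B = A ∖ {v, u₁, u₂}`
  have h1A' : u₁ ∈ A.erase v := mem_erase.2 ⟨h1v, h1A⟩
  have h2A' : u₂ ∈ (A.erase v).erase u₁ := mem_erase.2 ⟨h12.symm, mem_erase.2 ⟨h2v, h2A⟩⟩
  have hB : v ∉ ((A.erase v).erase u₁).erase u₂ := fun h => (notMem_erase v A) (mem_of_mem_erase (mem_of_mem_erase h))
  have hsumA : ∑ a ∈ A, μ.real (openConn o a) = μ.real (openConn o v) + μ.real (openConn o u₁) + μ.real (openConn o u₂) +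
      ∑ b ∈ ((A.erase v).erase u₁).erase u₂, μ.real (openConn o b) := by
    rw [← add_sum_erase A _ hvA, ← add_sum_erase (A.erase v) _ h1A', ← add_sum_erase ((A.erase v).erase u₁) _ h2A']
    ring
  have hout : ((((A.erase v).erase u₁).erase u₂).card : ℝ) - ∑ b ∈ ((A.erase v).erase u₁).erase u₂, μ.real (openConn o b) ≤
      ((((A.erase v).erase u₁).erase u₂).card : ℝ) * t := by
    have h1 : ∀ b ∈ ((A.erase v).erase u₁).erase u₂, 1 - μ.real (openConn o b) ≤ t := by
      intro b hb
      have := hcut b (mem_of_mem_erase (mem_of_mem_erase (mem_of_mem_erase hb)))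
      rw [hcomp] at this
      exact this
    have h2 := Finset.sum_le_sum h1
    rw [Finset.sum_sub_distrib, Finset.sum_const, Finset.sum_const, nsmul_eq_mul, nsmul_eq_mul, mul_one] at h2
    exact h2
  have hsub := Gate3.sum_real_openConn_out_le w hw hov h1v h2v ho1 ho2 h12 (((A.erase v).erase u₁).erase u₂) hB
  -- the laws (files III, V, VIII)
  have hN := Gate3.real_card_le_one_le_K w hw hov h1v h2v ho1 ho2 h12 A hvA h1A h2A
  have hLv := Gate3.real_compl_openConn_v_eq (v := v) w hw hov h1v h2v ho1 ho2 h12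
  have hL1 := Gate3.real_compl_openConn_u₁_eq (v := v) w hw hov h1v h2v ho1 ho2 h12
  have hL2 := Gate3.real_compl_openConn_u₂_eq (v := v) w hw hov h1v h2v ho1 ho2 h12
  rw [← hμ] at hN hLv hL1 hL2 hsub
  have hqv : μ.real (openConn o v) = 1 - μ.real (openConn o v : Set (BondConfig (Fin n)))ᶜ := by rw [hcomp]; ring
  have hq1 : μ.real (openConn o u₁) = 1 - μ.real (openConn o u₁ : Set (BondConfig (Fin n)))ᶜ := by rw [hcomp]; ring
  have hq2 : μ.real (openConn o u₂) = 1 - μ.real (openConn o u₂ : Set (BondConfig (Fin n)))ᶜ := by rw [hcomp]; ring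
  have hcutv := hcut v hvA
  have hcut₁ := hcut u₁ h1A
  have hcut₂ := hcut u₂ h2A
  rw [hsumA, hqv, hq1, hq2] at hEN
  generalize hS : ∑ b ∈ ((A.erase v).erase u₁).erase u₂, μ.real (openConn o b) = S at hsub hout hEN
  -- the eight-state bound in the fifteen cells (file XI)
  have hK0 := Gate3.real_nGnG_K0_eq (o := o) (v := v) (u₁ := u₁) (u₂ := u₂) μ (((A.erase v).erase u₁).erase u₂)
  have hKle := Gate3.real_nGnG_Kle_eq (o := o) (v := v) (u₁ := u₁) (u₂ := u₂) μ (((A.erase v).erase u₁).erase u₂)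
  have hI1 := Gate3.real_nG₁_imp_eq (o := o) (v := v) (u₁ := u₁) (u₂ := u₂) μ (((A.erase v).erase u₁).erase u₂)
  have hI2 := Gate3.real_nG₂_imp_eq (o := o) (v := v) (u₁ := u₁) (u₂ := u₂) μ (((A.erase v).erase u₁).erase u₂)
  have hAM := Gate3.real_atMostOne_eq (o := o) (v := v) (u₁ := u₁) (u₂ := u₂) μ (((A.erase v).erase u₁).erase u₂)
  have hKle0 := Gate3.real_split_Kle (o := o) (v := v) μ (((A.erase v).erase u₁).erase u₂)
    (fun η => ¬ (openGraph η).Reachable o u₁ ∧ ¬ (openGraph η).Reachable o u₂ ∧ ¬ (openGraph η).Reachable u₁ u₂)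
  have hKle3 := Gate3.real_split_Kle (o := o) (v := v) μ (((A.erase v).erase u₁).erase u₂)
    (fun η => ¬ (openGraph η).Reachable o u₁ ∧ ¬ (openGraph η).Reachable o u₂ ∧ (openGraph η).Reachable u₁ u₂)
  rw [hAM] at hN
  rw [hI1, hI2] at hN
  rw [hKle, hK0] at hN
  rw [hKle0, hKle3] at hN
  -- type masses, Harris rows (file V) and the splits of the types by `K` (file XI)
  have hx := Gate3.real_nG₁nG₂_eq (o := o) (v := v) (u₁ := u₁) (u₂ := u₂) μ
  have hy1 := Gate3.real_nG₁_eq (o := o) (v := v) (u₁ := u₁) (u₂ := u₂) μ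
  have hy2 := Gate3.real_nG₂_eq (o := o) (v := v) (u₁ := u₁) (u₂ := u₂) μ
  have hh1 := Gate3.real_nG₁nH_eq (o := o) (v := v) (u₁ := u₁) (u₂ := u₂) μ
  have hh2 := Gate3.real_nG₂nH_eq (o := o) (v := v) (u₁ := u₁) (u₂ := u₂) μ
  have hnh := Gate3.real_nH_eq (o := o) (v := v) (u₁ := u₁) (u₂ := u₂) μ
  have hh1' : μ.real {ω : BondConfig (Fin n) | ¬ (openGraph (offZ {v} ω)).Reachable o u₁ ∧ ¬ (openGraph (offZ {v} ω)).Reachable u₁ u₂} =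
      μ.real {ω : BondConfig (Fin n) | ¬ (openGraph (offZ {v} ω)).Reachable o u₁ ∧ ¬ (openGraph (offZ {v} ω)).Reachable o u₂ ∧ ¬ (openGraph (offZ {v} ω)).Reachable u₁ u₂} + μ.real {ω : BondConfig (Fin n) | (openGraph (offZ {v} ω)).Reachable o u₂ ∧ ¬ (openGraph (offZ {v} ω)).Reachable o u₁} := by
    have e : {ω : BondConfig (Fin n) | ¬ (openGraph (offZ {v} ω)).Reachable o u₁ ∧ ¬ (openGraph (offZ {v} ω)).Reachable u₁ u₂} =
        {ω : BondConfig (Fin n) | ¬ (openGraph (offZ {v} ω)).Reachable o u₁ ∧ ¬ (openGraph (offZ {v} ω)).Reachable u₂ u₁} := by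
      ext ω
      simp only [Set.mem_setOf_eq]
      exact ⟨fun h => ⟨h.1, fun h' => h.2 h'.symm⟩, fun h => ⟨h.1, fun h' => h.2 h'.symm⟩⟩
    rw [e]
    exact hh1
  have hsum := Gate3.real_types_sum (o := o) (v := v) (u₁ := u₁) (u₂ := u₂) μ
  rw [probReal_univ] at hsum
  have hH1 := Gate3.real_harris₁ (o := o) (v := v) (u₁ := u₁) (u₂ := u₂) w
  have hH2 := Gate3.real_harris₂ (o := o) (v := v) (u₁ := u₁) (u₂ := u₂) w
  have hH3 := Gate3.real_harris₃ (o := o) (v := v) (u₁ := u₁) (u₂ := u₂) w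
  rw [← hμ] at hH1 hH2 hH3
  -- the three K-rows (file XIX) and their cell form
  have hHK1 := Gate3.real_harrisK₁ (o := o) (v := v) (u₁ := u₁) w (((A.erase v).erase u₁).erase u₂)
  have hHK2 := Gate3.real_harrisK₂ (o := o) (v := v) (u₂ := u₂) w (((A.erase v).erase u₁).erase u₂)
  have hHK3 := Gate3.real_harrisK₃ (o := o) (v := v) (u₁ := u₁) (u₂ := u₂) w (((A.erase v).erase u₁).erase u₂)
  rw [← hμ] at hHK1 hHK2 hHK3
  have hG1e := Gate3.real_G₁_eq (o := o) (v := v) (u₁ := u₁) (u₂ := u₂) μ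
  have hG2e := Gate3.real_G₂_eq (o := o) (v := v) (u₁ := u₁) (u₂ := u₂) μ
  have hHe := Gate3.real_H_eq (o := o) (v := v) (u₁ := u₁) (u₂ := u₂) μ
  have hG1K := Gate3.real_G₁_K_eq (o := o) (v := v) (u₁ := u₁) μ (((A.erase v).erase u₁).erase u₂)
  have hG2K := Gate3.real_G₂_K_eq (o := o) (v := v) (u₂ := u₂) μ (((A.erase v).erase u₁).erase u₂)
  have hHK := Gate3.real_H_K_eq (o := o) (v := v) (u₁ := u₁) (u₂ := u₂) μ (((A.erase v).erase u₁).erase u₂)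
  have hG1K0 := Gate3.real_G₁K0_eq (o := o) (v := v) (u₁ := u₁) (u₂ := u₂) μ (((A.erase v).erase u₁).erase u₂)
  have hG2K0 := Gate3.real_G₂K0_eq (o := o) (v := v) (u₁ := u₁) (u₂ := u₂) μ (((A.erase v).erase u₁).erase u₂)
  have hHK0 := Gate3.real_HK0_eq (o := o) (v := v) (u₁ := u₁) (u₂ := u₂) μ (((A.erase v).erase u₁).erase u₂)
  have hK0e := Gate3.real_K0_eq (o := o) (v := v) (u₁ := u₁) μ (((A.erase v).erase u₁).erase u₂)
  have hnG1K0 := Gate3.real_nG₁K0_eq (o := o) (v := v) (u₁ := u₁) (u₂ := u₂) μ (((A.erase v).erase u₁).erase u₂)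
  have hK10 := Gate3.real_K1_add_K0 (o := o) (v := v) μ (((A.erase v).erase u₁).erase u₂)
  rw [probReal_univ] at hK10
  rw [hG1K0] at hG1K hK0e
  rw [hG2K0] at hG2K
  rw [hHK0] at hHK
  rw [hnG1K0, hK0] at hK0e
  have hK1e : μ.real {ω : BondConfig (Fin n) | 1 ≤ ((((A.erase v).erase u₁).erase u₂).filter fun b => offZ {v} ω ∈ openConn o b).card} = 1 - ((μ.real {ω : BondConfig (Fin n) | ((openGraph (offZ {v} ω)).Reachable o u₁ ∧ ¬ (openGraph (offZ {v} ω)).Reachable o u₂) ∧ ((((A.erase v).erase u₁).erase u₂).filter fun b => offZ {v} ω ∈ openConn o b).card = 0} + μ.real {ω : BondConfig (Fin n) | ((openGraph (offZ {v} ω)).Reachable o u₁ ∧ (openGraph (offZ {v} ω)).Reachable o u₂) ∧ ((((A.erase v).erase u₁).erase u₂).filter fun b => offZ {v} ω ∈ openConn o b).card = 0}) + ((μ.real {ω : BondConfig (Fin n) | (¬ (openGraph (offZ {v} ω)).Reachable o u₁ ∧ ¬ (openGraph (offZ {v} ω)).Reachable o u₂ ∧ ¬ (openGraph (offZ {v}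 ω)).Reachable u₁ u₂) ∧ ((((A.erase v).erase u₁).erase u₂).filter fun b => offZ {v} ω ∈ openConn o b).card = 0} + μ.real {ω : BondConfig (Fin n) | (¬ (openGraph (offZ {v} ω)).Reachable o u₁ ∧ ¬ (openGraph (offZ {v} ω)).Reachable o u₂ ∧ (openGraph (offZ {v} ω)).Reachable u₁ u₂) ∧ ((((A.erase v).erase u₁).erase u₂).filter fun b => offZ {v} ω ∈ openConn o b).card = 0}) + μ.real {ω : BondConfig (Fin n) | ((openGraph (offZ {v} ω)).Reachable o u₂ ∧ ¬ (openGraph (offZ {v} ω)).Reachable o u₁) ∧ ((((A.erase v).erase u₁).erase u₂).filter fun b => offZ {v} ω ∈ openConn o b).card = 0})) := by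
    linarith only [hK10, hK0e]
  have e1 : μ.real {ω : BondConfig (Fin n) | (openGraph (offZ {v} ω)).Reachable o u₁ ∧ 1 ≤ ((((A.erase v).erase u₁).erase u₂).filter fun b => offZ {v} ω ∈ openConn o b).card} = μ.real {ω : BondConfig (Fin n) | (openGraph (offZ {v} ω)).Reachable o u₁} - (μ.real {ω : BondConfig (Fin n) | ((openGraph (offZ {v} ω)).Reachable o u₁ ∧ ¬ (openGraph (offZ {v} ω)).Reachable o u₂) ∧ ((((A.erase v).erase u₁).erase u₂).filter fun b => offZ {v} ω ∈ openConn o b).card = 0} + μ.real {ω : BondConfig (Fin n) | ((openGraph (offZ {v} ω)).Reachable o u₁ ∧ (openGraph (offZ {v} ω)).Reachable o u₂) ∧ ((((A.erase v).erase u₁).erase u₂).filter fun b => offZ {v} ω ∈ openConn o b).card = 0}) := by linarith only [hG1K]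
  have e2 : μ.real {ω : BondConfig (Fin n) | (openGraph (offZ {v} ω)).Reachable o u₂ ∧ 1 ≤ ((((A.erase v).erase u₁).erase u₂).filter fun b => offZ {v} ω ∈ openConn o b).card} = μ.real {ω : BondConfig (Fin n) | (openGraph (offZ {v} ω)).Reachable o u₂} - (μ.real {ω : BondConfig (Fin n) | ((openGraph (offZ {v} ω)).Reachable o u₂ ∧ ¬ (openGraph (offZ {v} ω)).Reachable o u₁) ∧ ((((A.erase v).erase u₁).erase u₂).filter fun b => offZ {v} ω ∈ openConn o b).card = 0} + μ.real {ω : BondConfig (Fin n) | ((openGraph (offZ {v} ω)).Reachable o u₁ ∧ (openGraph (offZ {v} ω)).Reachable o u₂) ∧ ((((A.erase v).erase u₁).erase u₂).filter fun b => offZ {v} ω ∈ openConn o b).card = 0}) := by linarith only [hG2K]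
  have e3 : μ.real {ω : BondConfig (Fin n) | (openGraph (offZ {v} ω)).Reachable u₁ u₂ ∧ 1 ≤ ((((A.erase v).erase u₁).erase u₂).filter fun b => offZ {v} ω ∈ openConn o b).card} = μ.real {ω : BondConfig (Fin n) | (openGraph (offZ {v} ω)).Reachable u₁ u₂} - (μ.real {ω : BondConfig (Fin n) | (¬ (openGraph (offZ {v} ω)).Reachable o u₁ ∧ ¬ (openGraph (offZ {v} ω)).Reachable o u₂ ∧ (openGraph (offZ {v} ω)).Reachable u₁ u₂) ∧ ((((A.erase v).erase u₁).erase u₂).filter fun b => offZ {v} ω ∈ openConn o b).card = 0} + μ.real {ω : BondConfig (Fin n) | ((openGraph (offZ {v} ω)).Reachable o u₁ ∧ (openGraph (offZ {v} ω)).Reachable o u₂) ∧ ((((A.erase v).erase u₁).erase u₂).filter fun b => offZ {v} ω ∈ openConn o b).card = 0}) := by linarith only [hHK]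
  rw [hK1e, e1, hG1e] at hHK1
  rw [hK1e, e2, hG2e] at hHK2
  rw [hK1e, e3, hHe] at hHK3
  have hsa := Gate3.real_split_K (o := o) (v := v) μ (((A.erase v).erase u₁).erase u₂)
    (fun η => ¬ (openGraph η).Reachable o u₁ ∧ ¬ (openGraph η).Reachable o u₂ ∧ ¬ (openGraph η).Reachable u₁ u₂)
  have hsb1 := Gate3.real_split_K (o := o) (v := v) μ (((A.erase v).erase u₁).erase u₂)
    (fun η => (openGraph η).Reachable o u₁ ∧ ¬ (openGraph η).Reachable o u₂)
  have hsb2 := Gate3.real_split_K (o := o) (v := v) μ (((A.erase v).erase u₁).erase u₂)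
    (fun η => (openGraph η).Reachable o u₂ ∧ ¬ (openGraph η).Reachable o u₁)
  have hsc := Gate3.real_split_K (o := o) (v := v) μ (((A.erase v).erase u₁).erase u₂)
    (fun η => ¬ (openGraph η).Reachable o u₁ ∧ ¬ (openGraph η).Reachable o u₂ ∧ (openGraph η).Reachable u₁ u₂)
  have hsd := Gate3.real_split_K (o := o) (v := v) μ (((A.erase v).erase u₁).erase u₂)
    (fun η => (openGraph η).Reachable o u₁ ∧ (openGraph η).Reachable o u₂)
  -- abstract the fifteen cells …
  generalize hgxa0 : μ.real {ω : BondConfig (Fin n) | (¬ (openGraph (offZ {v} ω)).Reachable o u₁ ∧ ¬ (openGraph (offZ {v} ω)).Reachable o u₂ ∧ ¬ (openGraph (offZ {v} ω)).Reachable u₁ u₂) ∧ ((((A.erase v).erase u₁).erase u₂).filter fun b => offZ {v} ω ∈ openConn o b).card = 0} = xa0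
    at hN hsub hsa hHK1 hHK2 hHK3
  generalize hgxa1 : μ.real {ω : BondConfig (Fin n) | (¬ (openGraph (offZ {v} ω)).Reachable o u₁ ∧ ¬ (openGraph (offZ {v} ω)).Reachable o u₂ ∧ ¬ (openGraph (offZ {v} ω)).Reachable u₁ u₂) ∧ ((((A.erase v).erase u₁).erase u₂).filter fun b => offZ {v} ω ∈ openConn o b).card = 1} = xa1
    at hN hsub hsa
  generalize hgxa2 : μ.real {ω : BondConfig (Fin n) | (¬ (openGraph (offZ {v} ω)).Reachable o u₁ ∧ ¬ (openGraph (offZ {v} ω)).Reachable o u₂ ∧ ¬ (openGraph (offZ {v} ω)).Reachable u₁ u₂) ∧ 2 ≤ ((((A.erase v).erase u₁).erase u₂).filter fun b => offZ {v} ω ∈ openConn o b).card} = xa2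
    at hsub hsa
  generalize hgxb10 : μ.real {ω : BondConfig (Fin n) | ((openGraph (offZ {v} ω)).Reachable o u₁ ∧ ¬ (openGraph (offZ {v} ω)).Reachable o u₂) ∧ ((((A.erase v).erase u₁).erase u₂).filter fun b => offZ {v} ω ∈ openConn o b).card = 0} = xb10
    at hN hsub hsb1 hHK1 hHK2 hHK3
  generalize hgxb11 : μ.real {ω : BondConfig (Fin n) | ((openGraph (offZ {v} ω)).Reachable o u₁ ∧ ¬ (openGraph (offZ {v} ω)).Reachable o u₂) ∧ ((((A.erase v).erase u₁).erase u₂).filter fun b => offZ {v} ω ∈ openConn o b).card = 1} = xb11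
    at hsub hsb1
  generalize hgxb12 : μ.real {ω : BondConfig (Fin n) | ((openGraph (offZ {v} ω)).Reachable o u₁ ∧ ¬ (openGraph (offZ {v} ω)).Reachable o u₂) ∧ 2 ≤ ((((A.erase v).erase u₁).erase u₂).filter fun b => offZ {v} ω ∈ openConn o b).card} = xb12
    at hsub hsb1
  generalize hgxb20 : μ.real {ω : BondConfig (Fin n) | ((openGraph (offZ {v} ω)).Reachable o u₂ ∧ ¬ (openGraph (offZ {v} ω)).Reachable o u₁) ∧ ((((A.erase v).erase u₁).erase u₂).filter fun b => offZ {v} ω ∈ openConn o b).card = 0} = xb20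
    at hN hsub hsb2 hHK1 hHK2 hHK3
  generalize hgxb21 : μ.real {ω : BondConfig (Fin n) | ((openGraph (offZ {v} ω)).Reachable o u₂ ∧ ¬ (openGraph (offZ {v} ω)).Reachable o u₁) ∧ ((((A.erase v).erase u₁).erase u₂).filter fun b => offZ {v} ω ∈ openConn o b).card = 1} = xb21
    at hsub hsb2
  generalize hgxb22 : μ.real {ω : BondConfig (Fin n) | ((openGraph (offZ {v} ω)).Reachable o u₂ ∧ ¬ (openGraph (offZ {v} ω)).Reachable o u₁) ∧ 2 ≤ ((((A.erase v).erase u₁).erase u₂).filter fun b => offZ {v} ω ∈ openConn o b).card} = xb22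
    at hsub hsb2
  generalize hgxc0 : μ.real {ω : BondConfig (Fin n) | (¬ (openGraph (offZ {v} ω)).Reachable o u₁ ∧ ¬ (openGraph (offZ {v} ω)).Reachable o u₂ ∧ (openGraph (offZ {v} ω)).Reachable u₁ u₂) ∧ ((((A.erase v).erase u₁).erase u₂).filter fun b => offZ {v} ω ∈ openConn o b).card = 0} = xc0
    at hN hsub hsc hHK1 hHK2 hHK3
  generalize hgxc1 : μ.real {ω : BondConfig (Fin n) | (¬ (openGraph (offZ {v} ω)).Reachable o u₁ ∧ ¬ (openGraph (offZ {v} ω)).Reachable o u₂ ∧ (openGraph (offZ {v} ω)).Reachable u₁ u₂) ∧ ((((A.erase v).erase u₁).erase u₂).filter fun b => offZ {v} ω ∈ openConn o b).card = 1} = xc1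
    at hN hsub hsc
  generalize hgxc2 : μ.real {ω : BondConfig (Fin n) | (¬ (openGraph (offZ {v} ω)).Reachable o u₁ ∧ ¬ (openGraph (offZ {v} ω)).Reachable o u₂ ∧ (openGraph (offZ {v} ω)).Reachable u₁ u₂) ∧ 2 ≤ ((((A.erase v).erase u₁).erase u₂).filter fun b => offZ {v} ω ∈ openConn o b).card} = xc2
    at hsub hsc
  generalize hgxd0 : μ.real {ω : BondConfig (Fin n) | ((openGraph (offZ {v} ω)).Reachable o u₁ ∧ (openGraph (offZ {v} ω)).Reachable o u₂) ∧ ((((A.erase v).erase u₁).erase u₂).filter fun b => offZ {v} ω ∈ openConn o b).card = 0} = xd0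
    at hsub hsd hHK1 hHK2 hHK3
  generalize hgxd1 : μ.real {ω : BondConfig (Fin n) | ((openGraph (offZ {v} ω)).Reachable o u₁ ∧ (openGraph (offZ {v} ω)).Reachable o u₂) ∧ ((((A.erase v).erase u₁).erase u₂).filter fun b => offZ {v} ω ∈ openConn o b).card = 1} = xd1
    at hsub hsd
  generalize hgxd2 : μ.real {ω : BondConfig (Fin n) | ((openGraph (offZ {v} ω)).Reachable o u₁ ∧ (openGraph (offZ {v} ω)).Reachable o u₂) ∧ 2 ≤ ((((A.erase v).erase u₁).erase u₂).filter fun b => offZ {v} ω ∈ openConn o b).card} = xd2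
    at hsub hsd
  have hnxa0 : 0 ≤ xa0 := by rw [← hgxa0]; exact measureReal_nonneg
  have hnxa1 : 0 ≤ xa1 := by rw [← hgxa1]; exact measureReal_nonneg
  have hnxa2 : 0 ≤ xa2 := by rw [← hgxa2]; exact measureReal_nonneg
  have hnxb10 : 0 ≤ xb10 := by rw [← hgxb10]; exact measureReal_nonneg
  have hnxb11 : 0 ≤ xb11 := by rw [← hgxb11]; exact measureReal_nonneg
  have hnxb12 : 0 ≤ xb12 := by rw [← hgxb12]; exact measureReal_nonneg
  have hnxb20 : 0 ≤ xb20 := by rw [← hgxb20]; exact measureReal_nonneg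
  have hnxb21 : 0 ≤ xb21 := by rw [← hgxb21]; exact measureReal_nonneg
  have hnxb22 : 0 ≤ xb22 := by rw [← hgxb22]; exact measureReal_nonneg
  have hnxc0 : 0 ≤ xc0 := by rw [← hgxc0]; exact measureReal_nonneg
  have hnxc1 : 0 ≤ xc1 := by rw [← hgxc1]; exact measureReal_nonneg
  have hnxc2 : 0 ≤ xc2 := by rw [← hgxc2]; exact measureReal_nonneg
  have hnxd0 : 0 ≤ xd0 := by rw [← hgxd0]; exact measureReal_nonneg
  have hnxd1 : 0 ≤ xd1 := by rw [← hgxd1]; exact measureReal_nonneg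
  have hnxd2 : 0 ≤ xd2 := by rw [← hgxd2]; exact measureReal_nonneg
  -- … and the event probabilities
  generalize ha : μ.real {ω : BondConfig (Fin n) | ¬ (openGraph (offZ {v} ω)).Reachable o u₁ ∧ ¬ (openGraph (offZ {v} ω)).Reachable o u₂ ∧ ¬ (openGraph (offZ {v} ω)).Reachable u₁ u₂} = a at hx hh1 hh1' hh2 hnh hsum hH1 hH2 hH3 hsa
  generalize hb1 : μ.real {ω : BondConfig (Fin n) | (openGraph (offZ {v} ω)).Reachable o u₁ ∧ ¬ (openGraph (offZ {v} ω)).Reachable o u₂} = b₁ at hy2 hh2 hnh hsum hsb1 hHK1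
  generalize hb2 : μ.real {ω : BondConfig (Fin n) | (openGraph (offZ {v} ω)).Reachable o u₂ ∧ ¬ (openGraph (offZ {v} ω)).Reachable o u₁} = b₂ at hy1 hh1 hh1' hnh hsum hsb2 hHK2
  generalize hc : μ.real {ω : BondConfig (Fin n) | ¬ (openGraph (offZ {v} ω)).Reachable o u₁ ∧ ¬ (openGraph (offZ {v} ω)).Reachable o u₂ ∧ (openGraph (offZ {v} ω)).Reachable u₁ u₂} = c at hx hsum hsc hHK3
  generalize hd : μ.real {ω : BondConfig (Fin n) | (openGraph (offZ {v} ω)).Reachable o u₁ ∧ (openGraph (offZ {v} ω)).Reachable o u₂} = d at hsum hsd hHK1 hHK2 hHK3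
  generalize hxx : μ.real {ω : BondConfig (Fin n) | ¬ (openGraph (offZ {v} ω)).Reachable o u₁ ∧ ¬ (openGraph (offZ {v} ω)).Reachable o u₂} = x at hx hy1 hy2 hLv hL1 hL2 hH3
  generalize hyy1 : μ.real {ω : BondConfig (Fin n) | ¬ (openGraph (offZ {v} ω)).Reachable o u₁} = y₁ at hy1 hLv hL1 hH1
  generalize hyy2 : μ.real {ω : BondConfig (Fin n) | ¬ (openGraph (offZ {v} ω)).Reachable o u₂} = y₂ at hy2 hLv hL2 hH2
  generalize hhh1 : μ.real {ω : BondConfig (Fin n) | ¬ (openGraph (offZ {v} ω)).Reachable o u₁ ∧ ¬ (openGraph (offZ {v} ω)).Reachable u₂ u₁} = h₁ at hh1 hL1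
  generalize hhh1' : μ.real {ω : BondConfig (Fin n) | ¬ (openGraph (offZ {v} ω)).Reachable o u₁ ∧ ¬ (openGraph (offZ {v} ω)).Reachable u₁ u₂} = h₁' at hh1' hH2
  generalize hhh2 : μ.real {ω : BondConfig (Fin n) | ¬ (openGraph (offZ {v} ω)).Reachable o u₂ ∧ ¬ (openGraph (offZ {v} ω)).Reachable u₁ u₂} = h₂ at hh2 hL2 hH1
  generalize hnn : μ.real {ω : BondConfig (Fin n) | ¬ (openGraph (offZ {v} ω)).Reachable u₁ u₂} = nh at hnh hH3
  subst hx hy1 hy2 hh1 hh1' hh2 hnh hsa hsb1 hsb2 hsc hsd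
  rw [hLv] at hcutv hEN
  rw [hL1] at hcut₁ hEN
  rw [hL2] at hcut₂ hEN
  have key := hcover t S xa0 xa1 xa2 xb10 xb11 xb12 xb20 xb21 xb22 xc0 xc1 xc2 xd0 xd1 xd2
    hnxa0 hnxa1 hnxa2 hnxb10 hnxb11 hnxb12 hnxb20 hnxb21 hnxb22 hnxc0 hnxc1 hnxc2 hnxd0 hnxd1 hnxd2 (by linarith) hH1 hH2 hH3
    (by convert hHK1 using 2 <;> ring) (by convert hHK2 using 2 <;> ring) (by convert hHK3 using 2 <;> ring)
    (by linarith [hcutv]) (by linarith [hcut₁]) (by linarith [hcut₂]) hout (by linarith [hsub]) (by linarith [hEN])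
  linarith [hN, key]


end Quant

end Summit.CriticalPhenomena.PercolationContinuityZ3.Theorems
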